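import Summits.CriticalPhenomena.PercolationContinuityZ3.Theorems.PercNearOneGluingNoHeavyLowerTailPcovJ1TwoSource
import Summits.CriticalPhenomena.PercolationContinuityZ3.Theorems.PercNearOneGluingNoHeavyLowerTailCovTauBridge
import HarnessLib

/-!
# KN Question 8 at `|A| = 3`: `J1 ≥ 0` for the product measure — worlds `G ∖ C_N(ω)` of a source SET as zeroed-weight percolation

Support file (`--supports stmt-CriticalPhenomena-4575`, closed crux; independent mathematics on Kozma–Nitzan's Question 8 at
`|A| = 3`), prover `prim-hp-7` (gen 39).  No named facts, no sorries; standard axioms.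
Memo `prim-ineq-gen-6/FINDING-G13.md` §8 (`J1 := ⟨A⟩_Y − p·⟨h₁⟩_Y`) and `prim-hp-7/FROM-prim-hp-7-g39-J1-LEAN.md`.

`PcovJ1.j1_diag` (file `…PcovJ1TwoSource.lean`) proves `⟨e⟩_Y·⟨h₁⟩_Y ≤ ⟨α⟩_Y·⟨A⟩_Y` in the finite-sum world framework of `CovTau`.
This file reads it at the world `U = univ` for `μ = prodBernoulli p`, extending the dictionary of `…CovTauBridge.lean` (prim-hp-8, one
source vertex) to the cluster of a source SET `N`:
* `PcovJ1.delW p N ω` — the weights `p` zeroed on the pairs meeting the open vertex cluster `C_N(ω)` of the set `N`; percolation with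
  these weights is percolation on the world `G ∖ C_N(ω)` (`PcovJ1.sum_weight_rest_univ_set`, from `BHK2006.integral_comp_sdiff_prodBernoulli`);
* `PcovJ1.covW p N ω x v Ψ = Cov_{G ∖ C_N(ω)}(Ψ(C_x), 1{x ↔ v})` (unnormalised form `∫_{x↔v} Ψ − (∫ Ψ)·μ(x↔v)` of the zeroed-weight
  measure) and `PcovJ1.Bf_rest_univ_set : CovTau.Bf p (univ ∖ C_N(ω)) x v Ψ = covW p N ω x v Ψ`;
* `PcovJ1.Eav_univ`, `PcovJ1.Aw_univ`, `PcovJ1.Yw_univ` — the functionals `⟨e⟩, ⟨α⟩, Yw` at `U = univ` as measures / integrals;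
* `PcovJ1.j1_measure` — **J1 ≥ 0**: for `x ≠ v`, `x, v ∈ Z`, `Ψ` monotone nonnegative on vertex sets and every source set `Y`,
    `μ(v↔o, v↮{x}∪Y) · ∫_{x↮Y, o↮Z∪Y} Cov_{G∖C_{Y∪{o}}(ω)}(Ψ(C_x), 1{x↔v}) dμ(ω)
       ≤ μ(v↮{x}∪Y, o↮Z∪Y) · ∫_{x↮Y} Cov_{G∖C_Y(ω)}(Ψ(C_x), 1{x↔o}) dμ(ω)`,
  i.e. `⟨A⟩_Y ≥ p·⟨h₁⟩_Y` with `p = μ(o↔v, v↮x∪Y)/μ(v↮x∪Y, o↮Z∪Y)` — the covariance side of PCOV (FINDING-G13 §8: `PCOV = J1 + CEN`).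
[cite: VandenbergHaggstromKahn2005, Thm. 1.1 (pp. 3–5), §2.1 Lemmas 2.3–2.4 (p. 10)] [cite: Gladkov2024, Thm. 3.2 (p. 4)]
[cite: KozmaNitzan2024, Question 8 (§5.5 p. 36)]
-/

noncomputable section

namespace Summit.CriticalPhenomena.PercolationContinuityZ3.Theorems

namespace PcovJ1

open MeasureTheory Set Literature.Probability.Percolation
open Literature.Probability.LatticeModels (prodBernoulli)
open CovTau BHK2006 DecisionTree
open scoped Classical

variable {V : Type*} [Fintype V]

/-! ### Worlds `G ∖ C_N(ω)` as zeroed weights -/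

/-- The weights `p` zeroed on the pairs meeting the open vertex cluster of the SET `N` in `ω` (percolation on the world `G ∖ C_N(ω)`).
[cite: VandenbergHaggstromKahn2005, §2.1 Lemma 2.3 (p. 10)] -/
def delW (p : Sym2 V → unitInterval) (N : Set V) (ω : Set (Sym2 V)) : Sym2 V → unitInterval :=
  fun e => if (∃ u ∈ e, ∃ z ∈ N, (openGraph ω).Reachable z u) then 0 else p e

/-- `Cov_{G ∖ C_N(ω)}(Ψ(C_x), 1{x ↔ v})` in the unnormalised form `∫_{x↔v} Ψ(C_x) − (∫ Ψ(C_x))·μ(x↔v)` of the zeroed-weight measure.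
[cite: VandenbergHaggstromKahn2005, §1 p. 6] -/
def covW (p : Sym2 V → unitInterval) (N : Set V) (ω : Set (Sym2 V)) (x v : V) (Ψ : Set V → ℝ) : ℝ :=
  (∫ η in (openConn x v : Set (BondConfig V)), Ψ (openCluster η x) ∂(prodBernoulli (delW p N ω))) -
    (∫ η, Ψ (openCluster η x) ∂(prodBernoulli (delW p N ω))) * (prodBernoulli (delW p N ω)).real (openConn x v)

/-- In the world `univ ∖ C_N(ω)`, restricting a configuration deletes exactly the pairs meeting `C_N(ω)`.
[cite: VandenbergHaggstromKahn2005, §2.1 Lemma 2.3 (p. 10)] -/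
theorem inter_edgesIn_rest_univ_set (N : Set V) (ω η : Set (Sym2 V)) :
    η ∩ BHK2006.edgesIn (rest Finset.univ N ω) = η \ {e | ∃ u ∈ e, ∃ z ∈ N, (openGraph ω).Reachable z u} := by
  ext e
  simp only [mem_inter_iff, BHK2006.edgesIn, mem_setOf_eq, mem_sdiff, not_exists, not_and]
  constructor
  · rintro ⟨he, h⟩
    refine ⟨he, fun u hu z hz hr => ?_⟩
    exact (mem_rest.1 (h u hu)).2 (mem_sC_univ.2 ⟨z, hz, hr⟩)
  · rintro ⟨he, h⟩
    refine ⟨he, fun u hu => mem_rest.2 ⟨Finset.mem_univ u, fun hC => ?_⟩⟩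
    obtain ⟨z, hz, hr⟩ := mem_sC_univ.1 hC
    exact h u hu z hz hr

/-- **Fresh expectations in the world `G ∖ C_N(ω)` are zeroed-weight integrals.** [cite: VandenbergHaggstromKahn2005, §2.1 Lemmas 2.3–2.4 (p. 10)] -/
theorem sum_weight_rest_univ_set (p : Sym2 V → unitInterval) (N : Set V) (ω : Set (Sym2 V)) (G : Set (Sym2 V) → ℝ) :
    ∑ η, weight (fun e => (p e : ℝ)) η * G (η ∩ BHK2006.edgesIn (rest Finset.univ N ω)) =
      ∫ η, G η ∂(prodBernoulli (delW p N ω)) := by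
  simp only [inter_edgesIn_rest_univ_set]
  rw [sum_weight_mul_eq_integral,
    BHK2006.integral_comp_sdiff_prodBernoulli p {e | ∃ u ∈ e, ∃ z ∈ N, (openGraph ω).Reachable z u} G]
  congr 2
  funext e
  by_cases h : ∃ u ∈ e, ∃ z ∈ N, (openGraph ω).Reachable z u
  · rw [if_pos (show e ∈ {e : Sym2 V | ∃ u ∈ e, ∃ z ∈ N, (openGraph ω).Reachable z u} from h), delW, if_pos h]
  · rw [if_neg (show e ∉ {e : Sym2 V | ∃ u ∈ e, ∃ z ∈ N, (openGraph ω).Reachable z u} from h), delW, if_neg h]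

/-- **The world covariance `Bf` in `univ ∖ C_N(ω)` is `covW`.** [cite: VandenbergHaggstromKahn2005, §1 p. 6, §2.1 Lemmas 2.3–2.4 (p. 10)] -/
theorem Bf_rest_univ_set (p : Sym2 V → unitInterval) (x v : V) (Ψ : Set V → ℝ) (N : Set V) (ω : Set (Sym2 V)) :
    Bf (fun e => (p e : ℝ)) (rest Finset.univ N ω) x v Ψ = covW p N ω x v Ψ := by
  set U' := rest Finset.univ N ω with hU'
  have hsC : ∀ η : Set (Sym2 V), sC U' ({x} : Set V) η = openCluster (η ∩ BHK2006.edgesIn U') x := fun η =>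
    Set.ext fun u => by rw [mem_sC_singleton]; rfl
  have h1 : tf (fun e => (p e : ℝ)) U' x Ψ = ∫ η, Ψ (openCluster η x) ∂(prodBernoulli (delW p N ω)) := by
    unfold tf
    simp only [hsC]
    exact sum_weight_rest_univ_set p N ω (fun ζ => Ψ (openCluster ζ x))
  have h2 : cf (fun e => (p e : ℝ)) U' x v = (prodBernoulli (delW p N ω)).real (openConn x v) := by
    unfold cf
    rw [show (fun η : Set (Sym2 V) => weight (fun e => (p e : ℝ)) η *
        ind {η : Set (Sym2 V) | (openGraph (η ∩ BHK2006.edgesIn U')).Reachable x v} η) =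
        fun η => weight (fun e => (p e : ℝ)) η * ind (openConn x v : Set (BondConfig V)) (η ∩ BHK2006.edgesIn U') from rfl,
      sum_weight_rest_univ_set p N ω (fun ζ => ind (openConn x v : Set (BondConfig V)) ζ), ind_eq_indicator_one,
      integral_indicator_one MeasurableSet.of_discrete]
  have h3 : (∑ η, weight (fun e => (p e : ℝ)) η * (Ψ (sC U' ({x} : Set V) η) *
      ind {η : Set (Sym2 V) | (openGraph (η ∩ BHK2006.edgesIn U')).Reachable x v} η)) =
      ∫ η, Ψ (openCluster η x) * ind (openConn x v : Set (BondConfig V)) η ∂(prodBernoulli (delW p N ω)) := by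
    simp only [hsC]
    exact sum_weight_rest_univ_set p N ω (fun ζ => Ψ (openCluster ζ x) * ind (openConn x v : Set (BondConfig V)) ζ)
  unfold Bf covW
  rw [h1, h2, h3]
  congr 1
  rw [← integral_indicator MeasurableSet.of_discrete]
  congr 1
  funext η
  by_cases h : η ∈ (openConn x v : Set (BondConfig V))
  · rw [ind_of_mem h, mul_one, indicator_of_mem h]
  · rw [ind_of_not_mem h, mul_zero, indicator_of_notMem h]

/-! ### The functionals at `U = univ` -/

/-- `⟨e⟩_Y = μ(v ↔ o, v ↮ {x} ∪ Y)`. [folklore] -/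
theorem Eav_univ (p : Sym2 V → unitInterval) (x o v : V) (Y : Set V) :
    Eav (fun e => (p e : ℝ)) Finset.univ {x} o v Y =
      (prodBernoulli p).real (openConn v o ∩ {ω : BondConfig V | ∀ t ∈ insert x Y, ¬ (openGraph ω).Reachable v t}) := by
  rw [Eav, ← sum_weight_ind]
  refine Finset.sum_congr rfl fun ω _ => ?_
  congr 1
  rw [rC_univ, rD_univ, oInd_openEdgeCluster, ← ind_inter]
  refine BystanderBHK.ind_congr ?_
  simp only [mem_inter_iff, mem_setOf_eq, singleton_union]

/-- `⟨α⟩_Y = μ(v ↮ {x} ∪ Y, o ↮ Z ∪ Y)`. [folklore] -/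
theorem Aw_univ (p : Sym2 V → unitInterval) (x o v : V) (Z Y : Set V) :
    Aw (fun e => (p e : ℝ)) Finset.univ x o v Z Y =
      (prodBernoulli p).real ({ω : BondConfig V | ∀ t ∈ insert x Y, ¬ (openGraph ω).Reachable v t} ∩
        {ω | ∀ t ∈ Z ∪ Y, ¬ (openGraph ω).Reachable o t}) := by
  rw [Aw, ← sum_weight_ind]
  refine Finset.sum_congr rfl fun ω _ => ?_
  congr 1
  rw [← ind_inter]
  refine BystanderBHK.ind_congr ?_
  simp only [mem_inter_iff, mem_avoidAll_singleton, Finset.mem_univ, true_and, rD_univ, mem_setOf_eq, singleton_union]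

/-- `Yw F Y = ∫_{x ↮ Y} F(univ ∖ C_Y(ω)) dμ(ω)` for every world functional `F`. [folklore] -/
theorem Yw_univ (p : Sym2 V → unitInterval) (x : V) (F : Finset V → ℝ) (Y : Set V) :
    Yw (fun e => (p e : ℝ)) Finset.univ x F Y =
      ∫ ω in {ω : BondConfig V | ∀ t ∈ Y, ¬ (openGraph ω).Reachable x t}, F (rest Finset.univ Y ω) ∂(prodBernoulli p) := by
  rw [Yw, ← sum_weight_mul_ind]
  refine Finset.sum_congr rfl fun ω _ => ?_
  rw [rD_univ]

/-- `H2w(Y) = ∫_{x ↮ Y, o ↮ Z ∪ Y} Cov_{G ∖ C_{Y ∪ {o}}(ω)}(Ψ(C_x), 1{x↔v}) dμ(ω)`. [folklore] -/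
theorem H2w_univ (p : Sym2 V → unitInterval) (x o v : V) (Z : Set V) (Ψ : Set V → ℝ) (Y : Set V) :
    H2w (fun e => (p e : ℝ)) Finset.univ x o v Z Ψ Y =
      ∫ ω in {ω : BondConfig V | ∀ t ∈ Y, ¬ (openGraph ω).Reachable x t} ∩ {ω | ∀ t ∈ Z ∪ Y, ¬ (openGraph ω).Reachable o t},
        covW p (insert o Y) ω x v Ψ ∂(prodBernoulli p) := by
  rw [H2w, ← sum_weight_mul_ind]
  refine Finset.sum_congr rfl fun ω _ => ?_
  rw [Bf_rest_univ_set, ← ind_inter]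
  congr 2
  refine BystanderBHK.ind_congr ?_
  simp only [mem_inter_iff, mem_avoidAll_singleton, Finset.mem_univ, true_and, rD_univ, mem_setOf_eq]

/-! ### J1 ≥ 0 for `prodBernoulli` -/

/-- **J1 ≥ 0** (FINDING-G13 §8; the covariance side of PCOV / KN Question 8 at `|A| = 3`), product-measure form:
for `x ≠ v`, `x, v ∈ Z`, `Ψ` monotone nonnegative on vertex sets and every source set `Y`,
`μ(v↔o, v↮{x}∪Y) · ∫_{x↮Y, o↮Z∪Y} Cov_{G∖C_{Y∪{o}}(ω)}(Ψ(C_x),1{x↔v}) dμ ≤ μ(v↮{x}∪Y, o↮Z∪Y) · ∫_{x↮Y} Cov_{G∖C_Y(ω)}(Ψ(C_x),1{x↔o}) dμ`.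
[cite: VandenbergHaggstromKahn2005, Thm. 1.1 (pp. 3–5)] [cite: Gladkov2024, Thm. 3.2 (p. 4)] [cite: KozmaNitzan2024, Question 8 (§5.5 p. 36)] -/
theorem j1_measure (p : Sym2 V → unitInterval) {x o v : V} (hxv : x ≠ v) {Z : Set V} (hxZ : x ∈ Z) (hvZ : v ∈ Z)
    {Ψ : Set V → ℝ} (hΨ : ∀ S T : Set V, S ⊆ T → Ψ S ≤ Ψ T) (hΨ0 : ∀ S, 0 ≤ Ψ S) (Y : Set V) :
    (prodBernoulli p).real (openConn v o ∩ {ω : BondConfig V | ∀ t ∈ insert x Y, ¬ (openGraph ω).Reachable v t}) *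
        ∫ ω in {ω : BondConfig V | ∀ t ∈ Y, ¬ (openGraph ω).Reachable x t} ∩
            {ω | ∀ t ∈ Z ∪ Y, ¬ (openGraph ω).Reachable o t}, covW p (insert o Y) ω x v Ψ ∂(prodBernoulli p) ≤
      (prodBernoulli p).real ({ω : BondConfig V | ∀ t ∈ insert x Y, ¬ (openGraph ω).Reachable v t} ∩
          {ω | ∀ t ∈ Z ∪ Y, ¬ (openGraph ω).Reachable o t}) *
        ∫ ω in {ω : BondConfig V | ∀ t ∈ Y, ¬ (openGraph ω).Reachable x t}, covW p Y ω x o Ψ ∂(prodBernoulli p) := by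
  set w : Sym2 V → ℝ := fun e => (p e : ℝ) with hw
  have hw0 : ∀ e, 0 ≤ w e := fun e => (p e).2.1
  have hw1 : ∀ e, w e ≤ 1 := fun e => (p e).2.2
  have hm : ∑ ω, weight w ω = 1 := sum_weight_coe_eq_one p
  have key := j1_diag w hw0 hw1 hm (o := o) hxv hxZ hvZ hΨ hΨ0 Finset.univ (Y := Y)
    (fun _ _ => Finset.mem_coe.2 (Finset.mem_univ _))
  rw [Yw_Hw_eq w hm, Eav_univ, Aw_univ, H2w_univ, Yw_univ] at key
  have hA : (fun ω => Bf w (rest Finset.univ Y ω) x o Ψ) = fun ω => covW p Y ω x o Ψ :=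
    funext fun ω => Bf_rest_univ_set p x o Ψ Y ω
  rw [hA] at key
  exact key

end PcovJ1

end Summit.CriticalPhenomena.PercolationContinuityZ3.Theorems

end
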